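import Summits.PneNP.PneNP.Theorems.ConvexRankGatesLinAlgGateBlindFacetCount
import Summits.PneNP.PneNP.Theorems.ConvexRankGatesLinAlgGateBlindFacetDoor
import Summits.PneNP.PneNP.Theorems.ConvexRankGatesLinAlgGateBlindDetNormalForm

/-!
# Route ConvexRankGates, crux `LinAlgGateBlind` (stmt-PneNP-10681): facet count for linear pencils, VI — the GRANK facet door

Support theorems for the crux (vocabulary of `Theorems/ConvexRankGatesLinAlgGateBlindDefs.lean`). This file feeds
the facet count `card_facets_le` (`…FacetCount`: a `d × d` linear pencil on `n` matrices has at most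
`d^{2d} ∑_{k<2d} C(n,k)` maximal singular coordinate sets) into the facet cover `sgAt_of_facet_budget`
(`…FacetDoor`) for GRANK gates:

* `mergedPencil_map` — bookkeeping: a GRANK term gate in determinantal normal form `[det (K₀ + ∑_{live a} y_a K_a) ≠ 0]`
  (`exists_det_of_isGRankGate`) with atom map `a ↦ X_a ∈ 𝒱(l)` is modelled by the LINEAR pencil on the index set
  `Option 𝒱(l)` over the field `F'' = Frac F'[y]`: `K̃_none = K₀` (homogenising index) and
  `K̃_Y = ∑_{a : X_a = Y} y_a K_a` (inputs sharing an atom are merged, their variables becoming constants of `F''`);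
* `det_symbolicMatrix_eq_zero_iff_merged` — an atom family `A` is rejected iff `Ã = {none} ∪ A` is singular for the
  merged pencil (`←`: specialise all pencil variables to `1`; `→`: the substitution `y_a ↦ y_a t_{X_a}/t_none` into
  `Frac F''[t]` turns `K₀ + ∑ y_a K_a` into `t_none⁻¹ · M̃_Ã`);
* `card_detFacets_le` — hence the facets (maximal rejected atom families) of the gate inject into the facets of the
  merged pencil: at most `θ^{2θ} ∑_{k<2θ} C(#𝒱(l)+1, k)` of them;
* `sgAt_gRank_of_facet_budget` — **SG for `GRANK_s` from the facet count**: `SGAt m (IsGRankGate s) l k q ε` under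
  the positive budget and the fragility budget `(s^{2s} ∑_{k<2s} C(#𝒱(l)+1,k) + 1) · (1/2)^{ν+1} · #𝒱(l) < ε` — cover
  exponent `O(s log(s·#𝒱(l)))` in place of the live-span cover's `s² log #𝒱(l)` (`sgAt_gRank_of_chain_budget`).

Sequel: the range `s log(…) ≤ m^{7/8}/polylog` and the decoupled crux for every `γ < 7/8`. Sources: the tree's facet
count; Edmonds 1967 §5; Razborov 1985 / Alon–Boppana 1987 §3 (approximation method). No new definitions. [folklore]
-/

-- `Summit.PneNP.PneNP.…` duplicates `PneNP` BY DESIGN (single-problem summit).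
set_option linter.dupNamespace false

namespace Summit.PneNP.PneNP.Theorems

open Finset Matrix MvPolynomial Filter Literature.Computability.Complexity Razborov
open Summit.PneNP.PneNP.Cruxes.LinAlgGateBlind.DnfInvariantWideGatesSeeSmallCliques

/-! ### The merged linear pencil of a determinant term gate -/

section Merged

variable {m N θ : ℕ} {F' : Type*} [Field F']

/-- **The merged pencil under a ring homomorphism.** For the merged configuration `K̃` on `Option 𝒱` (`K̃_none = K₀`,
`K̃_Y = ∑_{a : X_a = Y} y_a K_a` over `F'' = Frac F'[y]`) and an atom family `A ⊆ 𝒱`, the image of the pencil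
`M̃_Ã = t_none K̃_none + ∑_{Y ∈ A} t_Y K̃_Y` under a ring homomorphism `h` is
`h(t_none) K₀ + ∑_{a : X_a ∈ A} h(t_{X_a}) h(y_a) K_a`. [folklore] -/
theorem mergedPencil_map (V : Finset (Finset (Fin m))) (K₀ : Matrix (Fin θ) (Fin θ) F')
    (K : Fin N → Matrix (Fin θ) (Fin θ) F') (Xat : Fin N → Finset (Fin m)) (hX : ∀ a, Xat a ∈ V)
    (A : Finset (Finset (Fin m))) {T : Type*} [CommRing T]
    (h : MvPolynomial (Option V) (FractionRing (MvPolynomial (Fin N) F')) →+* T) :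
    (∑ w ∈ insert none ((A.subtype (· ∈ V)).image some),
        (X w : MvPolynomial (Option V) (FractionRing (MvPolynomial (Fin N) F'))) •
          (w.elim (K₀.map (algebraMap F' (FractionRing (MvPolynomial (Fin N) F'))))
            (fun Y => ∑ a ∈ univ.filter (fun a => Xat a = (Y : Finset (Fin m))),
              (algebraMap (MvPolynomial (Fin N) F') (FractionRing (MvPolynomial (Fin N) F')) (X a)) •
                (K a).map (algebraMap F' (FractionRing (MvPolynomial (Fin N) F'))))).map
            (C : FractionRing (MvPolynomial (Fin N) F') →+*
              MvPolynomial (Option V) (FractionRing (MvPolynomial (Fin N) F')))).map h =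
      h (X none) • K₀.map (h.comp (C.comp (algebraMap F' (FractionRing (MvPolynomial (Fin N) F'))))) +
        ∑ a ∈ univ.filter (fun a => Xat a ∈ A),
          (h (X (some ⟨Xat a, hX a⟩)) *
            h (C (algebraMap (MvPolynomial (Fin N) F') (FractionRing (MvPolynomial (Fin N) F')) (X a)))) •
          (K a).map (h.comp (C.comp (algebraMap F' (FractionRing (MvPolynomial (Fin N) F'))))) := by
  classical
  have hnot : (none : Option V) ∉ (A.subtype (· ∈ V)).image some := by simp
  refine Matrix.ext fun i j => ?_
  simp only [Matrix.map_apply, Matrix.sum_apply, Matrix.smul_apply, Matrix.add_apply, smul_eq_mul, map_sum,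
    map_mul, RingHom.comp_apply]
  rw [Finset.sum_insert hnot, Finset.sum_image fun x _ y _ hxy => Option.some_injective _ hxy]
  congr 1
  rw [← Finset.sum_fiberwise_of_maps_to (s := univ.filter fun a => Xat a ∈ A) (t := A.subtype (· ∈ V))
    (g := fun a => (⟨Xat a, hX a⟩ : V)) (fun a ha => by
      rw [Finset.mem_subtype]
      exact (mem_filter.1 ha).2)]
  refine Finset.sum_congr rfl fun Y hY => ?_
  have hYA : (Y : Finset (Fin m)) ∈ A := Finset.mem_subtype.1 hY
  have hfilter : ((univ.filter fun a => Xat a ∈ A).filter fun a => (⟨Xat a, hX a⟩ : V) = Y) =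
      univ.filter fun a => Xat a = (Y : Finset (Fin m)) := by
    ext a
    simp only [mem_filter, mem_univ, true_and, Subtype.ext_iff]
    constructor
    · rintro ⟨-, h⟩
      exact h
    · intro h
      exact ⟨by rw [h]; exact hYA, h⟩
  rw [hfilter]
  simp only [Option.elim_some, Matrix.sum_apply, Matrix.smul_apply, Matrix.map_apply, smul_eq_mul, map_sum,
    map_mul, Finset.mul_sum]
  refine Finset.sum_congr rfl fun a ha => ?_
  have haY : (⟨Xat a, hX a⟩ : V) = Y := Subtype.ext (mem_filter.1 ha).2
  rw [haY]
  ring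

/-- **Rejection = singularity of the merged pencil.** For a determinant term gate with data `K₀, K_a` over `F'` and
atom map `a ↦ X_a ∈ 𝒱`, an atom family `A ⊆ 𝒱` is REJECTED — `det (K₀ + ∑_{a : X_a ∈ A} y_a K_a) = 0` over
`Frac F'[y]` — iff the coordinate set `Ã = {none} ∪ A` of the merged linear pencil `K̃` on `Option 𝒱` over
`F'' = Frac F'[y]` is SINGULAR. (`←`: specialise every pencil variable to `1`. `→`: the substitution
`y_a ↦ y_a t_{X_a} / t_none` into `Frac F''[t]` maps `K₀ + ∑ y_a K_a` to `t_none⁻¹ M̃_Ã`.) [folklore] -/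
theorem det_symbolicMatrix_eq_zero_iff_merged (V : Finset (Finset (Fin m))) (K₀ : Matrix (Fin θ) (Fin θ) F')
    (K : Fin N → Matrix (Fin θ) (Fin θ) F') (Xat : Fin N → Finset (Fin m)) (hX : ∀ a, Xat a ∈ V)
    (A : Finset (Finset (Fin m))) :
    (symbolicMatrix K₀ K (fun a => decide (Xat a ∈ A))).det = 0 ↔
    (∑ w ∈ insert none ((A.subtype (· ∈ V)).image some),
        (X w : MvPolynomial (Option V) (FractionRing (MvPolynomial (Fin N) F'))) •
          (w.elim (K₀.map (algebraMap F' (FractionRing (MvPolynomial (Fin N) F'))))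
            (fun Y => ∑ a ∈ univ.filter (fun a => Xat a = (Y : Finset (Fin m))),
              (algebraMap (MvPolynomial (Fin N) F') (FractionRing (MvPolynomial (Fin N) F')) (X a)) •
                (K a).map (algebraMap F' (FractionRing (MvPolynomial (Fin N) F'))))).map
            (C : FractionRing (MvPolynomial (Fin N) F') →+*
              MvPolynomial (Option V) (FractionRing (MvPolynomial (Fin N) F')))).det = 0 := by
  classical
  -- the symbolic matrix of the gate is the merged pencil with every pencil variable specialised to `1`
  set ev : MvPolynomial (Option V) (FractionRing (MvPolynomial (Fin N) F')) →+*
      FractionRing (MvPolynomial (Fin N) F') := MvPolynomial.eval fun _ => 1 with hev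
  have hsym : symbolicMatrix K₀ K (fun a => decide (Xat a ∈ A)) =
      ev (X none) • K₀.map (ev.comp (C.comp (algebraMap F' (FractionRing (MvPolynomial (Fin N) F'))))) +
        ∑ a ∈ univ.filter (fun a => Xat a ∈ A),
          (ev (X (some ⟨Xat a, hX a⟩)) *
            ev (C (algebraMap (MvPolynomial (Fin N) F') (FractionRing (MvPolynomial (Fin N) F')) (X a)))) •
          (K a).map (ev.comp (C.comp (algebraMap F' (FractionRing (MvPolynomial (Fin N) F'))))) := by
    rw [symbolicMatrix, ← Finset.sum_filter]
    refine Matrix.ext fun i j => ?_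
    simp only [hev, MvPolynomial.eval_X, MvPolynomial.eval_C, one_smul, one_mul, Matrix.add_apply,
      Matrix.sum_apply, Matrix.smul_apply, Matrix.map_apply, RingHom.comp_apply, decide_eq_true_eq]
  constructor
  · -- `→`: substitute `y_a ↦ y_a t_{X a} / t_none` into `Frac F''[t]`
    intro hdet
    set jt : MvPolynomial (Option V) (FractionRing (MvPolynomial (Fin N) F')) →+*
        FractionRing (MvPolynomial (Option V) (FractionRing (MvPolynomial (Fin N) F'))) :=
      algebraMap _ _ with hjtdef
    have hjt : Function.Injective jt := IsFractionRing.injective _ _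
    have ht0 : jt (X none) ≠ 0 := fun h =>
      (MvPolynomial.X_ne_zero (R := FractionRing (MvPolynomial (Fin N) F')) (none : Option V))
        (hjt (by rw [h, map_zero]))
    set Φ : MvPolynomial (Fin N) F' →+*
        FractionRing (MvPolynomial (Option V) (FractionRing (MvPolynomial (Fin N) F'))) :=
      MvPolynomial.eval₂Hom (jt.comp (C.comp (algebraMap F' (FractionRing (MvPolynomial (Fin N) F')))))
        (fun a => jt (C (algebraMap (MvPolynomial (Fin N) F') (FractionRing (MvPolynomial (Fin N) F')) (X a))) *
          jt (X (some ⟨Xat a, hX a⟩)) / jt (X none)) with hΦ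
    -- the killed generic symbolic matrix
    have hkill : (symbolicPolyMatrix K₀ K).map (killVars fun a => decide (Xat a ∈ A)) =
        K₀.map C + ∑ a ∈ univ.filter (fun a => Xat a ∈ A),
          (X a : MvPolynomial (Fin N) F') • (K a).map C := by
      refine Matrix.ext fun i j => ?_
      simp only [symbolicPolyMatrix, Matrix.map_apply, Matrix.add_apply, Matrix.sum_apply, Matrix.smul_apply,
        smul_eq_mul, map_add, map_sum, map_mul, killVars_X, MvPolynomial.algHom_C, MvPolynomial.algebraMap_eq,
        ite_mul, zero_mul]
      rw [← Finset.sum_filter]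
      simp only [decide_eq_true_eq]
    have hdetPoly : ((symbolicPolyMatrix K₀ K).map (killVars fun a => decide (Xat a ∈ A))).det = 0 := by
      have h := (det_submatrix_symbolicMatrix_eq_zero_iff K₀ K (fun a => decide (Xat a ∈ A)) id id).1
        (by simpa using hdet)
      rw [Matrix.submatrix_id_id] at h
      rw [← AlgHom.mapMatrix_apply, ← AlgHom.map_det, h]
    -- `jt` of the merged pencil is `t_none • Φ (killed symbolic matrix)`
    have hPM : jt (X none) • ((symbolicPolyMatrix K₀ K).map (killVars fun a => decide (Xat a ∈ A))).map Φ =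
        jt (X none) • K₀.map (jt.comp (C.comp (algebraMap F' (FractionRing (MvPolynomial (Fin N) F'))))) +
        ∑ a ∈ univ.filter (fun a => Xat a ∈ A),
          (jt (X (some ⟨Xat a, hX a⟩)) *
            jt (C (algebraMap (MvPolynomial (Fin N) F') (FractionRing (MvPolynomial (Fin N) F')) (X a)))) •
          (K a).map (jt.comp (C.comp (algebraMap F' (FractionRing (MvPolynomial (Fin N) F'))))) := by
      rw [hkill]
      refine Matrix.ext fun i j => ?_
      simp only [Matrix.map_apply, Matrix.add_apply, Matrix.sum_apply, Matrix.smul_apply, smul_eq_mul, map_add,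
        map_sum, map_mul, hΦ, MvPolynomial.eval₂Hom_X', MvPolynomial.eval₂Hom_C, RingHom.comp_apply,
        Finset.mul_sum, mul_add]
      congr 1
      refine Finset.sum_congr rfl fun a _ => ?_
      field_simp
    refine hjt ?_
    rw [map_zero, RingHom.map_det, RingHom.mapMatrix_apply, mergedPencil_map V K₀ K Xat hX A jt, ← hPM,
      Matrix.det_smul, ← RingHom.mapMatrix_apply, ← RingHom.map_det, hdetPoly, map_zero, mul_zero]
  · -- `←`: specialise every pencil variable to `1`
    intro hdet
    have h := congr_arg ev hdet
    rw [RingHom.map_det, RingHom.mapMatrix_apply, mergedPencil_map V K₀ K Xat hX A ev, map_zero] at h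
    rw [hsym]
    exact h

/-- **Facets of a determinant term gate are few.** Let `f` be a gate in determinantal normal form
(`f v = 1 ↔ det (K₀ + ∑_{vₐ=1} y_a K_a) ≠ 0`, data of dimension `θ` over a field `F'`) wired to atoms
`X_a ∈ 𝒱`. Then every family of FACETS of its rejection region over atom families — `A ⊆ 𝒱` rejected with every
`A ∪ {Y}`, `Y ∈ 𝒱 ∖ A`, accepted — has at most `θ^{2θ} · ∑_{k<2θ} C(#𝒱 + 1, k)` members: `A ↦ {none} ∪ A` maps facets
injectively to maximal singular coordinate sets of the merged linear pencil on `Option 𝒱`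
(`det_symbolicMatrix_eq_zero_iff_merged`, singularity being down-closed), counted by `card_facets_le`. [folklore] -/
theorem card_detFacets_le (V : Finset (Finset (Fin m))) {F' : Type} [Field F'] (K₀ : Matrix (Fin θ) (Fin θ) F')
    (K : Fin N → Matrix (Fin θ) (Fin θ) F') (Xat : Fin N → Finset (Fin m)) (hX : ∀ a, Xat a ∈ V)
    (f : (Fin N → Bool) → Bool) (hf : ∀ v, f v = true ↔ (symbolicMatrix K₀ K v).det ≠ 0)
    (𝓕 : Finset (Finset (Finset (Fin m))))
    (h𝓕 : ∀ A ∈ 𝓕, A ⊆ V ∧ f (fun a => decide (Xat a ∈ A)) = false ∧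
      ∀ Y ∈ V, Y ∉ A → f (fun a => decide (Xat a ∈ insert Y A)) = true) :
    #𝓕 ≤ θ ^ (2 * θ) * ∑ k ∈ range (2 * θ), (#V + 1).choose k := by
  classical
  set F'' := FractionRing (MvPolynomial (Fin N) F') with hF''
  set ι' := algebraMap F' F'' with hι'
  set ybar : Fin N → F'' := fun a => algebraMap (MvPolynomial (Fin N) F') F'' (X a) with hybar
  -- the merged configuration and its pencils
  set Kt : Option V → Matrix (Fin θ) (Fin θ) F'' := fun w =>
    w.elim (K₀.map ι') (fun Y => ∑ a ∈ univ.filter (fun a => Xat a = (Y : Finset (Fin m))),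
      ybar a • (K a).map ι') with hKt
  set Mt : Finset (Option V) → Matrix (Fin θ) (Fin θ) (MvPolynomial (Option V) F'') := fun W =>
    ∑ w ∈ W, (X w : MvPolynomial (Option V) F'') • (Kt w).map (C : F'' →+* MvPolynomial (Option V) F'') with hMt
  set code : Finset (Finset (Fin m)) → Finset (Option V) := fun A =>
    insert none ((A.subtype (· ∈ V)).image some) with hcode
  -- rejection = singularity of the coded set
  have hrej : ∀ A : Finset (Finset (Fin m)), f (fun a => decide (Xat a ∈ A)) = false ↔ (Mt (code A)).det = 0 := by
    intro A
    have hiff : f (fun a => decide (Xat a ∈ A)) = false ↔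
        (symbolicMatrix K₀ K (fun a => decide (Xat a ∈ A))).det = 0 := by
      constructor
      · intro h0
        by_contra hne
        rw [(hf _).2 hne] at h0
        exact Bool.noConfusion h0
      · intro h0
        cases hv : f (fun a => decide (Xat a ∈ A))
        · rfl
        · exact absurd h0 ((hf _).1 hv)
    exact hiff.trans (det_symbolicMatrix_eq_zero_iff_merged V K₀ K Xat hX A)
  -- singularity is down-closed
  have hdown : ∀ W W₀ : Finset (Option V), W₀ ⊆ W → (Mt W).det = 0 → (Mt W₀).det = 0 := by
    intro W W₀ hsub h0
    have h := pencil_map_kill_of_superset Kt hsub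
    simp only [hMt] at h0 ⊢
    rw [← h, ← AlgHom.mapMatrix_apply, ← AlgHom.map_det, h0, map_zero]
  -- the code of a facet is a maximal singular set
  have hmax : ∀ A ∈ 𝓕, Maximal (fun W : Finset (Option V) => (Mt W).det = 0) (code A) := by
    intro A hA
    obtain ⟨hAV, hArej, hAacc⟩ := h𝓕 A hA
    refine ⟨(hrej A).1 hArej, fun W hW hle => ?_⟩
    intro w hw
    cases w with
    | none => exact mem_insert_self _ _
    | some Y =>
      by_contra hY
      have hYA : (Y : Finset (Fin m)) ∉ A := fun h =>
        hY (mem_insert_of_mem (mem_image_of_mem _ (Finset.mem_subtype.2 h)))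
      -- `code (insert Y A) ⊆ W` is singular, so `insert Y A` is rejected: contradiction
      have hsub : code (insert (Y : Finset (Fin m)) A) ⊆ W := by
        intro w' hw'
        rcases mem_insert.1 hw' with rfl | hw'
        · exact hle (mem_insert_self _ _)
        · obtain ⟨Y', hY', rfl⟩ := mem_image.1 hw'
          rcases mem_insert.1 (Finset.mem_subtype.1 hY') with h | h
          · have : Y' = Y := Subtype.ext h
            rw [this]
            exact hw
          · exact hle (mem_insert_of_mem (mem_image_of_mem _ (Finset.mem_subtype.2 h)))
      have hsing : (Mt (code (insert (Y : Finset (Fin m)) A))).det = 0 := hdown W _ hsub hW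
      have hrej' := (hrej _).2 hsing
      rw [hAacc Y Y.2 hYA] at hrej'
      exact Bool.noConfusion hrej'
  -- the code is injective on families of subfamilies of `V`
  have hinj : Set.InjOn code 𝓕 := by
    intro A₁ hA₁ A₂ hA₂ h
    have key : ∀ {A₁ A₂}, A₁ ∈ 𝓕 → code A₁ = code A₂ → A₁ ⊆ A₂ := by
      intro A₁ A₂ hA₁ h Y hY
      have hYV : Y ∈ V := (h𝓕 A₁ hA₁).1 hY
      have h1 : some ⟨Y, hYV⟩ ∈ code A₁ :=
        mem_insert_of_mem (mem_image_of_mem _ (Finset.mem_subtype.2 hY))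
      rw [h] at h1
      rcases mem_insert.1 h1 with h2 | h2
      · exact absurd h2 (Option.some_ne_none _)
      · obtain ⟨Y', hY', hYY'⟩ := mem_image.1 h2
        have : Y' = ⟨Y, hYV⟩ := Option.some_injective _ hYY'
        rw [← show (Y' : Finset (Fin m)) = Y from congr_arg Subtype.val this]
        exact Finset.mem_subtype.1 hY'
    exact Subset.antisymm (key hA₁ h) (key hA₂ h.symm)
  -- count
  calc #𝓕 = #(𝓕.image code) := (card_image_of_injOn hinj).symm
    _ ≤ θ ^ (2 * θ) * ∑ k ∈ range (2 * θ), (Fintype.card (Option V)).choose k := by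
        refine card_facets_le Kt (𝓕.image code) fun W hW => ?_
        obtain ⟨A, hA, rfl⟩ := mem_image.1 hW
        exact hmax A hA
    _ = θ ^ (2 * θ) * ∑ k ∈ range (2 * θ), (#V + 1).choose k := by
        rw [Fintype.card_option, Fintype.card_coe]

end Merged

/-! ### SG for GRANK gates from the facet count -/

/-- **SG for `GRANK_s` from the facet count.** Let `q ∈ [0,1]`, `1 - q^{C(l,2)} ≤ 1/2`, `0 < ε`, `2t ≤ l`, the positive
budget `(ν·C(l,2))^t · C(m-t,k-t) ≤ ε·C(m,k)` and the fragility budget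
`(s^{2s} · ∑_{k<2s} C(#𝒱(l)+1, k) + 1) · (1/2)^{ν+1} · #𝒱(l) < ε`. Then `SGAt m (IsGRankGate s) l k q ε`: GRANK gates
are monotone, every GRANK gate of dimension `≤ s` is identically false (one facet: `𝒱(l)` itself) or a determinant
gate of dimension `θ ≤ s` (`exists_det_of_isGRankGate`) whose facet families have at most
`θ^{2θ} ∑_{k<2θ} C(#𝒱(l)+1,k)` members (`card_detFacets_le`), and the facet cover `sgAt_of_facet_budget` concludes.
The cover exponent is `O(s · log(s · #𝒱(l)))` — against `s² · log #𝒱(l)` for the live-span cover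
`sgAt_gRank_of_chain_budget`. [folklore] -/
theorem sgAt_gRank_of_facet_budget : ∀ (m l k s ν t : ℕ) (q ε : ℝ), 0 ≤ q → q ≤ 1 →
    1 - q ^ (l.choose 2) ≤ 1 / 2 → 0 < ε → 2 * t ≤ l →
    (((ν * l.choose 2) ^ t * (m - t).choose (k - t) : ℕ) : ℝ) ≤ ε * (m.choose k : ℝ) →
    ((s ^ (2 * s) * ∑ j ∈ range (2 * s), (#(smallSets (Fin m) l) + 1).choose j + 1 : ℕ) : ℝ) *
      (1 / 2) ^ (ν + 1) * #(smallSets (Fin m) l) < ε →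
    SGAt m (IsGRankGate s) l k q ε := by
  intro m l k s ν t q ε hq0 hq1 hql hε htl hpos hfrag
  classical
  set V := smallSets (Fin m) l with hVdef
  refine sgAt_of_facet_budget m l k _ ν t q ε (IsGRankGate s) (fun g hg => hg.monotone) ?_ hq0 hq1 hql hε htl
    hpos hfrag
  intro g hg Xat hX 𝓕 h𝓕
  rcases exists_det_of_isGRankGate hg with hfalse | ⟨F', _, θ, hθs, K₀, K, hgK⟩
  · -- identically false: the only facet is `V` itself
    have hsub : 𝓕 ⊆ {V} := by
      intro A hA
      obtain ⟨hAV, -, hAacc⟩ := h𝓕 A hA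
      rw [mem_singleton]
      refine Subset.antisymm hAV fun Y hY => ?_
      by_contra hYA
      have h := hAacc Y hY hYA
      rw [hfalse] at h
      exact Bool.noConfusion h
    calc #𝓕 ≤ #({V} : Finset (Finset (Finset (Fin m)))) := card_le_card hsub
      _ = 1 := card_singleton V
      _ ≤ s ^ (2 * s) * ∑ j ∈ range (2 * s), (#V + 1).choose j + 1 := Nat.le_add_left 1 _
  · -- a determinant gate of dimension `θ ≤ s`
    have h := card_detFacets_le V K₀ K Xat hX g.2 hgK 𝓕 h𝓕
    refine h.trans (Nat.le_succ_of_le ?_)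
    rcases Nat.eq_zero_or_pos s with hs | hs
    · subst hs
      have hθ : θ = 0 := Nat.le_zero.1 hθs
      subst hθ
      exact le_rfl
    · refine Nat.mul_le_mul ?_ ?_
      · exact (Nat.pow_le_pow_left hθs _).trans (Nat.pow_le_pow_right hs (by omega))
      · exact sum_le_sum_of_subset (range_subset_range.2 (by omega))

end Summit.PneNP.PneNP.Theorems
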